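import Summits.BirchSwinnertonDyer.BirchSwinnertonDyer.Theses.BiquadraticEisensteinDescent
import Literature.NumberTheory.EllipticCurves.BSDRootNumberNoContinuationProofs
import HarnessLib

set_option linter.dupNamespace false -- `Summit.BirchSwinnertonDyer.BirchSwinnertonDyer.Theorems.…` (summit = sub)
set_option autoImplicit false

/-!
# Crux `HeegnerTwistCouplingInSupply` (stmt-BirchSwinnertonDyer-21381), line `size-tail`: the CONTINUATION PRICE of the
# crux and of its parent KS_R (stmt-BirchSwinnertonDyer-20713) — kernel record for the planner (lead `bsd-line-ibd-p1` g0)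

THEOREMS ONLY, unconditional, no new definitions; `--supports stmt-BirchSwinnertonDyer-21381`. Nothing about the
coupling itself or any case of BSD is asserted.

What is recorded. Both the crux `HeegnerTwistCouplingInSupply` (item 21381) and its parent
`HeegnerFieldSupplyCMInertBadKPrime` (KS_R, item 20713) conclude, at every pair `(W, p)` of the CM inert-bad corner,
`∃ K′ …, (W.quadraticTwist (d_K′ : ℚ)).entireLFunction 1 ≠ 0 ∧ …`. In the tree `WeierstrassCurve.entireLFunction` is
the classical choice of THE entire continuation of Mathlib's `L`-series when one exists and — documented junk value —
the `L`-series itself otherwise; and for an ELLIPTIC curve over `ℚ` the junk branch has `L(W, 1) = 0`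
(`WeierstrassCurve.entireLFunction_one_eq_zero_of_not_hasEntireLFunction`: the series `∑ aₙ n⁻¹` does not converge
absolutely, `∑_{p good} 1/p = ∞`). Hence (this file):

* `hasEntireLFunction_quadraticTwist_discr_of_entireLFunction_one_ne_zero` — the conjunct
  `(W.quadraticTwist (d_K′ : ℚ)).entireLFunction 1 ≠ 0` already PROVES `(W.quadraticTwist (d_K′ : ℚ)).HasEntireLFunction`
  (the twist is elliptic since `d_K′ ≠ 0`, Mathlib `NumberField.discr_ne_zero`);
* `exists_hasEntireLFunction_quadraticTwist_of_heegnerTwistCouplingInSupply` — any proof of the crux 21381 yields, at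
  every corner pair `(W, p)` carrying the ∀B class-number supply, a Heegner field `K′` of `N_W` with `p ∤ h(K′)` AND an
  entire continuation of `L(W^{(d_K′)}, s)`;
* `exists_hasEntireLFunction_quadraticTwist_of_heegnerFieldSupplyCMInertBadKPrime` — the same for the parent KS_R.

Why the planner may care (numbers, not adjectives): in the present tree `HasEntireLFunction` of an elliptic curve over
`ℚ` is available ONLY from the two named facts `WeierstrassCurve.hasEntireLFunction_rat` (modularity, BCDT 2001 Thm A)
and `hasEntireLFunction_of_j_mem_maximalCMJInvariants` (Deuring–Hecke), both unproved `Prop`s, or from a hypothesis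
(`W.analyticRank ≠ 0`, `W.entireLFunction 1 ≠ 0`). The corner hypothesis `W.analyticRank = 1` gives the continuation of
`L(W, s)` (`hasEntireLFunction_of_analyticRank_ne_zero`) but NOT of `L(W^{(d)}, s)` for any `d` outside the square class
of `1`; so, independently of the open coupling, a closer of 21381 / 20713 BY ITS OWN SIGNATURE contains a continuation
transfer `L(W,s) entire ⇒ L(W^{(d_K′)},s) entire` that the tree can supply today only through one of the two facts —
i.e. the items as typed can be LANDED conditionally (`hasEntireLFunction_rat → …`) but not closed `proved` until a
continuation leaf is a theorem. A restatement that isolates the coupling would thread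
`WeierstrassCurve.hasEntireLFunction_rat →` (already conjunct 5 of the route's `PublishedInputsBiquadratic`) or phrase
the non-vanishing conjunct as `(W.quadraticTwist (d_K′ : ℚ)).analyticRank = 0` (junk-robust by
`analyticRank_eq_zero_of_not_hasEntireLFunction`). This is bookkeeping about the statement's currency, not progress on
the coupling, which stays open (engine census v1.3; PRESEARCH v1.1; OBSTRUCTIONS seat1 g2–g5 / seat2 g3–g7 on the item).
BSD is not proved by any of this.
-/

noncomputable section

open scoped Classical NumberField

open WeierstrassCurve NumberField
  Literature.NumberTheory.EllipticCurves Literature.NumberTheory.EllipticCurves.Rank1Residual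

namespace Summit.BirchSwinnertonDyer.BirchSwinnertonDyer.Theorems.BiquadraticEisensteinDescentHeegnerTwistCouplingInSupplyContinuationPrice

open Summit.BirchSwinnertonDyer.BirchSwinnertonDyer.Theses.BiquadraticEisensteinDescent

/-- **The non-vanishing conjunct certifies the continuation of the twist.** For an elliptic `W / ℚ` and a number
field `K′`, if the tree's value `L(W^{(d_K′)}, 1) = (W.quadraticTwist (d_K′ : ℚ)).entireLFunction 1` is non-zero, then
`L(W^{(d_K′)}, s)` has an entire continuation: the twist is elliptic (`d_K′ ≠ 0`), and in the junk branch of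
`entireLFunction` the value at `1` is `0` (`entireLFunction_one_eq_zero_of_not_hasEntireLFunction`). [folklore] -/
theorem hasEntireLFunction_quadraticTwist_discr_of_entireLFunction_one_ne_zero
    (W : WeierstrassCurve ℚ) [W.IsElliptic] (K : Type) [Field K] [NumberField K]
    (h : (W.quadraticTwist (NumberField.discr K : ℚ)).entireLFunction 1 ≠ 0) :
    (W.quadraticTwist (NumberField.discr K : ℚ)).HasEntireLFunction := by
  have hd : (NumberField.discr K : ℚ) ≠ 0 := by exact_mod_cast NumberField.discr_ne_zero K
  haveI := W.isElliptic_quadraticTwist hd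
  exact (W.quadraticTwist (NumberField.discr K : ℚ)).hasEntireLFunction_of_entireLFunction_one_ne_zero h

/-- **Continuation price of the crux `HeegnerTwistCouplingInSupply` (item 21381).** Any proof of the crux yields, at
every pair `(W, p)` of the CM inert-bad corner (rank one, `p ≥ 5`) carrying the ∀B class-number supply, a Heegner field
`K′` of `N_W` with `4 < |d_K′|`, `p ∤ h(K′)` and an ENTIRE CONTINUATION of `L(W^{(d_K′)}, s)` — a datum the tree can
supply today only from the named facts `hasEntireLFunction_rat` / `hasEntireLFunction_of_j_mem_maximalCMJInvariants`.
Kernel record of the statement's currency; nothing about the coupling is asserted. [folklore] -/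
theorem exists_hasEntireLFunction_quadraticTwist_of_heegnerTwistCouplingInSupply
    (h : HeegnerTwistCouplingInSupply) :
    ∀ (W : WeierstrassCurve ℚ) [W.IsElliptic] [W.IsGloballyMinimal] (p : ℕ) [Fact p.Prime]
      [NeZero (W.conductorNorm ℤ)],
      W.HasCM → W.analyticRank = 1 → 5 ≤ p → CMInert W p → ¬ Good W p →
      (∀ B : ℕ, ∃ (K : Type) (_ : Field K) (_ : NumberField K), IsImaginaryQuadratic K ∧
        B < (NumberField.discr K).natAbs ∧ 4 < (NumberField.discr K).natAbs ∧
        SatisfiesHeegnerHypothesis (W.conductorNorm ℤ) K ∧ ¬ p ∣ NumberField.classNumber K) →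
      ∃ (K : Type) (_ : Field K) (_ : NumberField K), IsImaginaryQuadratic K ∧
        4 < (NumberField.discr K).natAbs ∧ SatisfiesHeegnerHypothesis (W.conductorNorm ℤ) K ∧
        ¬ p ∣ NumberField.classNumber K ∧
        (W.quadraticTwist (NumberField.discr K : ℚ)).HasEntireLFunction := by
  intro W _ _ p _ _ hCM hr hp5 hin hbad hsup
  obtain ⟨K, iF, iN, hK, hd4, hHN, hL, hp⟩ := h W p hCM hr hp5 hin hbad hsup
  exact ⟨K, iF, iN, hK, hd4, hHN, hp,
    hasEntireLFunction_quadraticTwist_discr_of_entireLFunction_one_ne_zero W K hL⟩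

/-- **Continuation price of the parent KS_R `HeegnerFieldSupplyCMInertBadKPrime` (item 20713).** Any proof of KS_R
yields, at every pair `(W, p)` of the CM inert-bad corner (rank one, `p ≥ 5`), a Heegner field `K′` of `N_W` with
`4 < |d_K′|`, `p ∤ h(K′)` and an entire continuation of `L(W^{(d_K′)}, s)`. Same remark as for the child.
[folklore] -/
theorem exists_hasEntireLFunction_quadraticTwist_of_heegnerFieldSupplyCMInertBadKPrime
    (h : HeegnerFieldSupplyCMInertBadKPrime) :
    ∀ (W : WeierstrassCurve ℚ) [W.IsElliptic] [W.IsGloballyMinimal] (p : ℕ) [Fact p.Prime]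
      [NeZero (W.conductorNorm ℤ)],
      W.HasCM → W.analyticRank = 1 → 5 ≤ p → CMInert W p → ¬ Good W p →
      ∃ (K : Type) (_ : Field K) (_ : NumberField K), IsImaginaryQuadratic K ∧
        4 < (NumberField.discr K).natAbs ∧ SatisfiesHeegnerHypothesis (W.conductorNorm ℤ) K ∧
        ¬ p ∣ NumberField.classNumber K ∧
        (W.quadraticTwist (NumberField.discr K : ℚ)).HasEntireLFunction := by
  intro W _ _ p _ _ hCM hr hp5 hin hbad
  obtain ⟨K, iF, iN, hK, hd4, hHN, hL, hp⟩ := h W p hCM hr hp5 hin hbad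
  exact ⟨K, iF, iN, hK, hd4, hHN, hp,
    hasEntireLFunction_quadraticTwist_discr_of_entireLFunction_one_ne_zero W K hL⟩

/-- **The corner curve itself needs no continuation leaf.** At a corner pair the hypothesis `W.analyticRank = 1`
already gives `W.HasEntireLFunction` (`hasEntireLFunction_of_analyticRank_ne_zero`): the price above concerns the
TWIST only. [folklore] -/
theorem hasEntireLFunction_of_analyticRank_eq_one (W : WeierstrassCurve ℚ) [W.IsElliptic]
    (hr : W.analyticRank = 1) : W.HasEntireLFunction :=
  W.hasEntireLFunction_of_analyticRank_ne_zero (by omega)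

end Summit.BirchSwinnertonDyer.BirchSwinnertonDyer.Theorems.BiquadraticEisensteinDescentHeegnerTwistCouplingInSupplyContinuationPrice

end
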